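import Literature.Barriers.QuantumAdvantage.Relativization
import Literature.Computability.Cryptography.OneWayFunctionsRel
import Literature.Computability.QuantumComplexity.CountingSimulationRelProofs
import HarnessLib

/-!
# Barrier catalogue `QuantumAdvantage`: Fortnow–Rogers' question — a relativized world with CRYPTOGRAPHIC one-way functions and `BPP = BQP` (template (c) of `SupremacyTheoremsNonRelativizing`, average-case form)

D-0021 companion entry of `SupremacyTheoremsNonRelativizing.lean` for the summit
`QuantumAdvantage` (`∃ L, L ∈ BQP ∧ L ∉ BPP`). Template (c) there — "one-way functions exist ⟹
`BPP ≠ BQP`" does not relativize (`not_relativizes_owf_template`, from the PROVED oracle fact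
`fortnowRogers1999_thm42`: `P^C = BPP^C = BQP^C ≠ UP^C ∩ coUP^C`) — concerns WORST-CASE one-way
functions ("one-to-one, honest, and not invertible in polynomial time", Fortnow–Rogers §2.5,
equivalent to `P ≠ UP` by Grollmann–Selman), and its `scope_caveats` record the gap to the
cryptographic notion. The printed source of the gap (L. Fortnow, J. Rogers, *Complexity
limitations on quantum computation*, JCSS 59 (1999); arXiv:cs/9811023, §4.1 "Cryptographic
One-Way Functions", p. 7 of the arXiv text): "The assumption `P ≠ UP` does not necessarily imply
the existence of cryptographic one-way functions, i.e., functions not invertible on a large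
fraction of inputs with nonuniform polynomial-size circuits. Whether there exists a relativized
world where `BPP = BQP` and cryptographic one-way functions exist remains an interesting open
question." (They add, p. 7–8: relative to a random oracle cryptographic one-way functions exist
[their ref. IR = Impagliazzo–Rudich, STOC 1989], so `P = BQP` for random oracles — provable
perhaps "under some assumption like `P = PSPACE`" by a relativizable proof, then joined to an
oracle with `P = PSPACE` — "would yield a relativized world where `P = BQP` and cryptographic
one-way functions exist"; and Thm. 4.4: "If `P = BQP` relative to a random oracle then `BQP = BPP`".)

**What this file adds** (definitions with bodies and proved readings; NO named fact, nothing is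
asserted about the existence of such a world):

* (vocabulary, in `Literature/Computability/Cryptography/OneWayFunctionsRel.lean`:
  `IsOneWayRel O f`, `IsOneWayNonuniformRel O f`, `OWFExistRel O`, `NonuniformOWFExistRel O` — the
  `O`-relativizations of the tree's `IsOneWay`, `IsOneWayNonuniform`, `OWFExist`,
  `NonuniformOWFExist` over C4a `OracleAdversary` inverters, with
  `NonuniformOWFExistRel.owfExistRel` and the sanity anchor `not_isOneWayRel_const`);
* the world predicates `CryptoOWFCollapseWorld A` (`OWFExistRel (Oracle.ofLanguage A)` and
  `BQP^A ⊆ BPP^A` — the hypothesis of the "Minicrypt ⟹ quantum advantage" door in the tree's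
  uniform vocabulary `OWFExist`) and `CryptoOWFCollapseWorldNonuniform A` (Fortnow–Rogers' printed
  wording: nonuniform inverters), with `CryptoOWFCollapseWorldNonuniform.cryptoOWFCollapseWorld`
  and the "`BPP = BQP`" equality forms (`cryptoOWFCollapseWorld_iff_eq` given the tree fact
  `BPPRel_ofLanguage_subset_BQPRel`; hypothesis-free `cryptoOWFCollapseWorld_iff_eq'` through its
  discharge `BPPRel_ofLanguage_subset_BQPRel_holds`, `CountingSimulationRelProofs.lean`);
* the readings over the technique class `Literature.Barriers.PneNP.Relativizes`, all proved and all
  hypothesis-free except for the existence of the world: such a world is EXACTLY a failure of the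
  template `O ↦ (OWFExistRel O → BQP^O ⊄ BPP^O)` to relativize
  (`exists_cryptoOWFCollapseWorld_iff_not_relativizes`; one direction is the requested
  `not_relativizes_cryptoOWF_template_of`, the summit-shaped variant
  `not_relativizes_cryptoOWF_summit_template_of`), and likewise for the nonuniform template
  (`exists_cryptoOWFCollapseWorldNonuniform_iff_not_relativizes`), which moreover kills the uniform
  template too (`not_relativizes_cryptoOWF_template_of_nonuniform`). Contrapositively, a
  relativizing proof of "cryptographic one-way functions ⟹ `BQP ⊄ BPP`" is the same thing as a
  proof that Fortnow–Rogers' world does not exist.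

## Design notes

* The inverter model (C4a `OracleAdversary`, input `(1ⁿ, f x)`, success event, advice convention,
  negligibility) is documented in `OneWayFunctionsRel.lean`; Fortnow–Rogers' "nonuniform
  polynomial-size circuits" are the advised PPT oracle machines of `IsOneWayNonuniformRel`.
* `CryptoOWFCollapseWorld` is typed with the inclusion `BQP^A ⊆ BPP^A` (the negation of the
  summit's relativized shape, as in templates (a)–(c) of the sibling); the printed "`BPP = BQP`" is
  recovered by `cryptoOWFCollapseWorld_iff_eq` from `BPP^A ⊆ BQP^A`.
* The existence statement `∃ A, CryptoOWFCollapseWorld A` is deliberately NOT given a name of its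
  own: it is a question, not a result in print, so it is neither a Literature fact nor a
  definition; the theorems below take it (or produce it) explicitly.
* Not here: any claim about random oracles (Impagliazzo–Rudich one-wayness of a random oracle;
  Fortnow–Rogers Thm. 4.4; the Aaronson–Ambainis route to `P = BQP` for random oracles, see
  `RandomOracleMethod.lean`), and nothing about the unrelativized door `OWFExist → QuantumAdvantage`
  itself (`OWFExist` is over G01 `RandAlg` inverters; no bridge to `OWFExistRel Oracle.empty` is
  claimed, see `OneWayFunctionsRel.lean`).

## Sources

* [FortnowRogers1999JCSS] arXiv:cs/9811023, read via `lit read arxiv:cs/9811023`: §2.5 (p. 4: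
  worst-case one-way functions; "these one-way functions may not be suitable for cryptographic
  purposes which require average-case hardness against nonuniform inverters"), §4.1 (p. 7–8,
  quoted above), Thm. 4.1, Thm. 4.2, Thm. 4.4 (p. 7).
* [Goldreich2001] O. Goldreich, *Foundations of Cryptography I*, CUP 2001: Def. 2.2.1, §2.2.5
  (Def. 2.2.6, Prop. 2.2.7) — as used in `OneWayFunctions.lean` / `OneWayFunctionsRel.lean`.
* [BernsteinVazirani1997SICOMP] Thm. 8.3 (`BPP ⊆ BQP`), as relativized in
  `CountingSimulationRel.lean` (`BPPRel_ofLanguage_subset_BQPRel`) and discharged in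
  `CountingSimulationRelProofs.lean`.
* [AroraBarakCC2009] §3.4 and Thm. 3.7, p. 74 (relativizing results), as used in
  `Literature/Barriers/PneNP/Relativization.lean`.
-/

noncomputable section

namespace Literature.Barriers.QuantumAdvantage

open _root_.Computability Literature.Computability.Complexity
  Literature.Computability.Complexity.Classes Literature.Computability.Cryptography
  Literature.Computability.QuantumComplexity PneNP

/-! ### The Fortnow–Rogers world -/

/-- `CryptoOWFCollapseWorld A`: **the language `A` is a relativized world with cryptographic
one-way functions and no quantum advantage** — `OWFExistRel (Oracle.ofLanguage A)` (some
`f ∈ FP^A` is one-way against uniform PPT inverters with oracle `A`) and `BQP^A ⊆ BPP^A`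
(equivalently `BPP^A = BQP^A`, `cryptoOWFCollapseWorld_iff_eq`). Whether such an `A` exists is the
question Fortnow–Rogers raise, and leave unanswered, after Thm. 4.2 (whose oracle `C`,
`P^C = BPP^C = BQP^C ≠ UP^C ∩ coUP^C`, has only WORST-CASE one-way functions) — §4.1, p. 7, quoted
verbatim in the module docstring; their inverters are nonuniform (`CryptoOWFCollapseWorldNonuniform`,
which implies this predicate, `CryptoOWFCollapseWorldNonuniform.cryptoOWFCollapseWorld`). This
predicate DEFINES the world; its existence is not asserted anywhere in the tree, and by
`exists_cryptoOWFCollapseWorld_iff_not_relativizes` it is equivalent to the failure of the proof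
template "cryptographic one-way functions ⟹ `BQP ⊄ BPP`" to relativize.

BARRIER (conditional entry; companion of `SupremacyTheoremsNonRelativizing`, template (c))
technique_class: relativizing (oracle-independent, black-box) derivations of quantum advantage from generic, unstructured cryptographic hardness — "cryptographic one-way functions exist ⟹ `BQP ⊄ BPP`" (`O ↦ OWFExistRel O → BQP^O ⊄ BPP^O`), the average-case strengthening of Simon's question treated by Fortnow–Rogers Thm. 4.1/4.2 [cite: FortnowRogers1999JCSS, §4, Thm. 4.1, Thm. 4.2 and §4.1 (arXiv numbering, p. 7)].
blocks: IF some `A` satisfies `CryptoOWFCollapseWorld A`, every relativizing proof of "one-way functions (Goldreich Def. 2.2.1, uniform PPT inverters) ⟹ `BQP ⊄ BPP`" (`not_relativizes_cryptoOWF_template_of`, summit-shaped `not_relativizes_cryptoOWF_summit_template_of`); IF some `A` satisfies `CryptoOWFCollapseWorldNonuniform A`, also every relativizing proof from non-uniformly secure one-way functions (`not_relativizes_cryptoOWF_template_nonuniform_of`, `not_relativizes_cryptoOWF_template_of_nonuniform`) [cite: FortnowRogers1999JCSS, §4.1 (arXiv numbering, p. 7)] [cite: AroraBarakCC2009, §3.4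 and Thm. 3.7, p. 74].
because: a relativizing argument holds relative to every language oracle (`Relativizes`) [cite: AroraBarakCC2009, §3.4 p. 74]; at such an `A` the hypothesis `OWFExistRel (Oracle.ofLanguage A)` holds while the conclusion fails (`BQP^A ⊆ BPP^A`) — and conversely a failure of the template to relativize IS such a world (`exists_cryptoOWFCollapseWorld_iff_not_relativizes`) [cite: FortnowRogers1999JCSS, Thm. 4.1 ("will require nonrelativizing techniques") and §4.1 (arXiv numbering, p. 7)].
evasions_known: none published for the cryptographic template itself; Fortnow–Rogers' suggested construction of the world — prove `P = BQP` relative to a random oracle "under some assumption like `P = PSPACE`" by a relativizable proof and join a random oracle (relative to which cryptographic one-way functions exist, Impagliazzo–Rudich as cited there) to an oracle with `P = PSPACE` — is a programme, not a theorem, and by their Thm. 4.4 an unconditional `P = BQP` for random oracles would already give `BQP = BPP` [cite: FortnowRogers1999JCSS, §4.1 and Thm. 4.4 (arXiv numbering, pp. 7–8)]; non-black-box use of the one-way function evades relativization in the neighbouring `P/poly`-oracle setting (Aaronson–Chen Thm. 7.6: one-way functions ⟹ `BPP^O ≠ BQP^O` for some `O ∈ P/poly`; tree entry `PPolyOracles.lean`)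 [cite: AaronsonChen2017, Thm. 7.6].
scope_caveats: NOTHING here is a no-go theorem — the existence of the world is Fortnow–Rogers' unanswered question and enters every reading as an explicit hypothesis (or conclusion); the worst-case world of Thm. 4.2 (`fortnowRogers1999_thm42`, discharged as `fortnowRogers1999_thm42_holds` in `SupremacyTheoremsNonRelativizingAssembly.lean`) does not supply it, since `P ≠ UP` "does not necessarily imply the existence of cryptographic one-way functions" [cite: FortnowRogers1999JCSS, §4.1 (arXiv numbering, p. 7)]; models: inverters are C4a transcript `OracleAdversary`s (uniform; advice as an explicit input component for the nonuniform notion), `f ∈ FPRel`, `BQPRel` = uniform Clifford+T families with XOR-query gates to `A`, `BPPRel = bp (P^O)` — language oracles only; the printed "large fraction of inputs" is read as Goldreich's strong (negligible-success) one-wayness, and "BPP = BQP" as `BQP^A ⊆ BPP^A` (equivalent given `BPP^A ⊆ BQP^A`, `cryptoOWFCollapseWorld_iff_eq`); no statement about random oracles, `SampBQP`, or the unrelativized door `OWFExist → QuantumAdvantage` itself is made.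
status: unresolved question in print (posed [cite: FortnowRogers1999JCSS, §4.1 (arXiv numbering, p. 7)]; no construction and no impossibility proof published or in the tree); the definitions and the equivalences below are established. -/
def CryptoOWFCollapseWorld (A : Language Bool) : Prop :=
  OWFExistRel (Oracle.ofLanguage A) ∧ BQPRel A ⊆ BPPRel (Oracle.ofLanguage A)

/-- `CryptoOWFCollapseWorldNonuniform A`: Fortnow–Rogers' world in their printed wording —
relative to `A`, one-way functions secure against NON-UNIFORM polynomial-time inverters exist
(`NonuniformOWFExistRel`) and `BQP^A ⊆ BPP^A`. [cite: FortnowRogers1999JCSS, §4.1 (arXiv numbering, p. 7)] -/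
def CryptoOWFCollapseWorldNonuniform (A : Language Bool) : Prop :=
  NonuniformOWFExistRel (Oracle.ofLanguage A) ∧ BQPRel A ⊆ BPPRel (Oracle.ofLanguage A)

/-- Projection: the world has cryptographic one-way functions. [cite: FortnowRogers1999JCSS, §4.1 (arXiv numbering, p. 7)] -/
theorem CryptoOWFCollapseWorld.owfExistRel {A : Language Bool} (h : CryptoOWFCollapseWorld A) :
    OWFExistRel (Oracle.ofLanguage A) :=
  h.1

/-- Projection: the world has no quantum advantage, `BQP^A ⊆ BPP^A`. [cite: FortnowRogers1999JCSS, §4.1 (arXiv numbering, p. 7)] -/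
theorem CryptoOWFCollapseWorld.collapse {A : Language Bool} (h : CryptoOWFCollapseWorld A) :
    BQPRel A ⊆ BPPRel (Oracle.ofLanguage A) :=
  h.2

/-- Fortnow–Rogers' (nonuniform) world is in particular a world for the uniform notion.
[cite: FortnowRogers1999JCSS, §4.1 (arXiv numbering, p. 7)] [cite: Goldreich2001, Prop. 2.2.7 (§2.2.5)] -/
theorem CryptoOWFCollapseWorldNonuniform.cryptoOWFCollapseWorld {A : Language Bool}
    (h : CryptoOWFCollapseWorldNonuniform A) : CryptoOWFCollapseWorld A :=
  ⟨h.1.owfExistRel, h.2⟩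

/-- The printed wording "`BPP = BQP`": given the tree fact `BPP^A ⊆ BQP^A`
(`BPPRel_ofLanguage_subset_BQPRel`, Bernstein–Vazirani Thm. 8.3 relativized; discharged as
`BPPRel_ofLanguage_subset_BQPRel_holds` in `CountingSimulationRelProofs.lean`), the collapse half
of the world is the equality `BPP^A = BQP^A`. [cite: FortnowRogers1999JCSS, §4.1 (arXiv numbering, p. 7)] [cite: BernsteinVazirani1997SICOMP, Thm. 8.3] -/
theorem cryptoOWFCollapseWorld_iff_eq (hBQ : BPPRel_ofLanguage_subset_BQPRel) (A : Language Bool) :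
    CryptoOWFCollapseWorld A ↔
      OWFExistRel (Oracle.ofLanguage A) ∧ BPPRel (Oracle.ofLanguage A) = BQPRel A :=
  and_congr_right fun _ =>
    ⟨fun h => (hBQ A).antisymm h, fun h L hL => by rw [h]; exact hL⟩

/-- The same for the nonuniform world. [cite: FortnowRogers1999JCSS, §4.1 (arXiv numbering, p. 7)] [cite: BernsteinVazirani1997SICOMP, Thm. 8.3] -/
theorem cryptoOWFCollapseWorldNonuniform_iff_eq (hBQ : BPPRel_ofLanguage_subset_BQPRel)
    (A : Language Bool) :
    CryptoOWFCollapseWorldNonuniform A ↔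
      NonuniformOWFExistRel (Oracle.ofLanguage A) ∧ BPPRel (Oracle.ofLanguage A) = BQPRel A :=
  and_congr_right fun _ =>
    ⟨fun h => (hBQ A).antisymm h, fun h L hL => by rw [h]; exact hL⟩

/-- Fortnow–Rogers' wording, hypothesis-free: `CryptoOWFCollapseWorld A` iff cryptographic one-way
functions exist relative to `A` and `BPP^A = BQP^A` (the tree fact `BPP^A ⊆ BQP^A` fed by its
discharge `BPPRel_ofLanguage_subset_BQPRel_holds`). [cite: FortnowRogers1999JCSS, §4.1 (arXiv numbering, p. 7)] [cite: BernsteinVazirani1997SICOMP, Thm. 8.3] -/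
theorem cryptoOWFCollapseWorld_iff_eq' (A : Language Bool) :
    CryptoOWFCollapseWorld A ↔
      OWFExistRel (Oracle.ofLanguage A) ∧ BPPRel (Oracle.ofLanguage A) = BQPRel A :=
  cryptoOWFCollapseWorld_iff_eq BPPRel_ofLanguage_subset_BQPRel_holds A

/-- The same for the nonuniform world, hypothesis-free. [cite: FortnowRogers1999JCSS, §4.1 (arXiv numbering, p. 7)] [cite: BernsteinVazirani1997SICOMP, Thm. 8.3] -/
theorem cryptoOWFCollapseWorldNonuniform_iff_eq' (A : Language Bool) :
    CryptoOWFCollapseWorldNonuniform A ↔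
      NonuniformOWFExistRel (Oracle.ofLanguage A) ∧ BPPRel (Oracle.ofLanguage A) = BQPRel A :=
  cryptoOWFCollapseWorldNonuniform_iff_eq BPPRel_ofLanguage_subset_BQPRel_holds A

/-! ### The readings over `Relativizes` (proved) -/

/-- **The cryptographic template (c) fails to relativize at a Fortnow–Rogers world**: if some
`A` has cryptographic one-way functions and `BQP^A ⊆ BPP^A`, then
`O ↦ (OWFExistRel O → BQP^O ⊄ BPP^O)` — "one-way functions ⟹ quantum advantage" with Goldreich's
cryptographic one-way functions — does not relativize, for every oracle-indexed presentation `C`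
of `BQP^·` (`PresentsBQPRel C`); the pattern of the sibling's `not_relativizes_owf_template`.
[cite: FortnowRogers1999JCSS, Thm. 4.1 and §4.1 (arXiv numbering, p. 7)] [cite: AroraBarakCC2009, Thm. 3.7 and p. 74] -/
theorem not_relativizes_cryptoOWF_template_of (h : ∃ A, CryptoOWFCollapseWorld A)
    {C : Oracle → Set (Language Bool)} (hC : PresentsBQPRel C) :
    ¬ Relativizes fun O => OWFExistRel O → ¬ C O ⊆ BPPRel O := by
  obtain ⟨A, hOWF, hcoll⟩ := h
  intro hrel
  refine hrel A hOWF ?_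
  rw [hC A]
  exact hcoll

/-- The same in the summit's own shape (`QuantumAdvantage := ∃ L, L ∈ BQP ∧ L ∉ BPP`):
`O ↦ (OWFExistRel O → ∃ L ∈ BQP^O, L ∉ BPP^O)` does not relativize if a Fortnow–Rogers world
exists. [cite: FortnowRogers1999JCSS, Thm. 4.1 and §4.1 (arXiv numbering, p. 7)] [cite: AroraBarakCC2009, Thm. 3.7 and p. 74] -/
theorem not_relativizes_cryptoOWF_summit_template_of (h : ∃ A, CryptoOWFCollapseWorld A)
    {C : Oracle → Set (Language Bool)} (hC : PresentsBQPRel C) :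
    ¬ Relativizes fun O => OWFExistRel O → ∃ L ∈ C O, L ∉ BPPRel O := by
  intro hrel
  refine not_relativizes_cryptoOWF_template_of h hC fun A hOWF hsub => ?_
  obtain ⟨L, hL, hLB⟩ := hrel A hOWF
  exact hLB (hsub hL)

/-- **Fortnow–Rogers' question IS the relativization question for the cryptographic template**:
a world with cryptographic one-way functions and `BQP^A ⊆ BPP^A` exists iff
`O ↦ (OWFExistRel O → BQP^O ⊄ BPP^O)` fails to relativize (for any presentation `C` of `BQP^·`).
Contrapositively, a relativizing proof of "cryptographic one-way functions ⟹ `BQP ⊄ BPP`" is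
exactly a proof that no such world exists. [cite: FortnowRogers1999JCSS, §4.1 (arXiv numbering, p. 7)] [cite: AroraBarakCC2009, §3.4 and Thm. 3.7, p. 74] -/
theorem exists_cryptoOWFCollapseWorld_iff_not_relativizes {C : Oracle → Set (Language Bool)}
    (hC : PresentsBQPRel C) :
    (∃ A, CryptoOWFCollapseWorld A) ↔
      ¬ Relativizes fun O => OWFExistRel O → ¬ C O ⊆ BPPRel O := by
  refine ⟨fun h => not_relativizes_cryptoOWF_template_of h hC, fun h => ?_⟩
  by_contra hne
  refine h fun A hOWF hsub => hne ⟨A, hOWF, ?_⟩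
  rw [← hC A]
  exact hsub

/-- Summit-shaped form of the equivalence. [cite: FortnowRogers1999JCSS, §4.1 (arXiv numbering, p. 7)] [cite: AroraBarakCC2009, §3.4 and Thm. 3.7, p. 74] -/
theorem exists_cryptoOWFCollapseWorld_iff_not_relativizes_summit {C : Oracle → Set (Language Bool)}
    (hC : PresentsBQPRel C) :
    (∃ A, CryptoOWFCollapseWorld A) ↔
      ¬ Relativizes fun O => OWFExistRel O → ∃ L ∈ C O, L ∉ BPPRel O := by
  refine ⟨fun h => not_relativizes_cryptoOWF_summit_template_of h hC, fun h => ?_⟩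
  rw [exists_cryptoOWFCollapseWorld_iff_not_relativizes hC]
  intro hrel
  refine h fun A hOWF => ?_
  by_contra hno
  refine hrel A hOWF fun L hL => ?_
  by_contra hLB
  exact hno ⟨L, hL, hLB⟩

/-- **The nonuniform template fails to relativize at Fortnow–Rogers' printed world**:
`O ↦ (NonuniformOWFExistRel O → BQP^O ⊄ BPP^O)` does not relativize if some `A` satisfies
`CryptoOWFCollapseWorldNonuniform A`. [cite: FortnowRogers1999JCSS, §4.1 (arXiv numbering, p. 7)] [cite: AroraBarakCC2009, Thm. 3.7 and p. 74] -/
theorem not_relativizes_cryptoOWF_template_nonuniform_of (h : ∃ A, CryptoOWFCollapseWorldNonuniform A)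
    {C : Oracle → Set (Language Bool)} (hC : PresentsBQPRel C) :
    ¬ Relativizes fun O => NonuniformOWFExistRel O → ¬ C O ⊆ BPPRel O := by
  obtain ⟨A, hOWF, hcoll⟩ := h
  intro hrel
  refine hrel A hOWF ?_
  rw [hC A]
  exact hcoll

/-- Fortnow–Rogers' printed (nonuniform) world also kills the uniform template, through
`CryptoOWFCollapseWorldNonuniform.cryptoOWFCollapseWorld`. [cite: FortnowRogers1999JCSS, §4.1 (arXiv numbering, p. 7)] [cite: Goldreich2001, Prop. 2.2.7 (§2.2.5)] -/
theorem not_relativizes_cryptoOWF_template_of_nonuniform (h : ∃ A, CryptoOWFCollapseWorldNonuniform A)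
    {C : Oracle → Set (Language Bool)} (hC : PresentsBQPRel C) :
    ¬ Relativizes fun O => OWFExistRel O → ¬ C O ⊆ BPPRel O :=
  not_relativizes_cryptoOWF_template_of (let ⟨A, hA⟩ := h; ⟨A, hA.cryptoOWFCollapseWorld⟩) hC

/-- The nonuniform equivalence: Fortnow–Rogers' printed question is the relativization question
for the template from non-uniformly secure one-way functions. [cite: FortnowRogers1999JCSS, §4.1 (arXiv numbering, p. 7)] [cite: AroraBarakCC2009, §3.4 and Thm. 3.7, p. 74] -/
theorem exists_cryptoOWFCollapseWorldNonuniform_iff_not_relativizes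
    {C : Oracle → Set (Language Bool)} (hC : PresentsBQPRel C) :
    (∃ A, CryptoOWFCollapseWorldNonuniform A) ↔
      ¬ Relativizes fun O => NonuniformOWFExistRel O → ¬ C O ⊆ BPPRel O := by
  refine ⟨fun h => not_relativizes_cryptoOWF_template_nonuniform_of h hC, fun h => ?_⟩
  by_contra hne
  refine h fun A hOWF hsub => hne ⟨A, hOWF, ?_⟩
  rw [← hC A]
  exact hsub

/-- Hypothesis-free packaging for the canonical presentation `bqpRelOf`
(`O ↦ BQP^{oracleLanguage O}`): the two equivalences with no presentation hypothesis.
[cite: FortnowRogers1999JCSS, §4.1 (arXiv numbering, p. 7)] [cite: AroraBarakCC2009, §3.4 and Thm. 3.7, p. 74] -/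
theorem exists_cryptoOWFCollapseWorld_iff_canonical :
    ((∃ A, CryptoOWFCollapseWorld A) ↔
        ¬ Relativizes fun O => OWFExistRel O → ¬ bqpRelOf O ⊆ BPPRel O) ∧
      ((∃ A, CryptoOWFCollapseWorldNonuniform A) ↔
        ¬ Relativizes fun O => NonuniformOWFExistRel O → ¬ bqpRelOf O ⊆ BPPRel O) :=
  ⟨exists_cryptoOWFCollapseWorld_iff_not_relativizes presentsBQPRel_bqpRelOf,
    exists_cryptoOWFCollapseWorldNonuniform_iff_not_relativizes presentsBQPRel_bqpRelOf⟩

end Literature.Barriers.QuantumAdvantage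

end
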